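import Mathlib
import HarnessLib.Audit
import Summits.PneNP.PneNP.Theorems.PstarCycleCoreKillsShared
import Summits.PneNP.PneNP.Theorems.PstarMultiSiblingJoins

/-!
# The multi-sibling member kill on cycle cores and on general cores (even list): the census check-lists (ROUND-24, O1; memo g29 §84)

FRONTIER range-avoidance ladder, rung F-N3, ROUND 24 (cell `pnp-ideate`, prover-2 memo `g29/O1-SIBLINGS-g29.md` §84; census node
`PstarLocalGateBudgetAssembly.LocalMenuCriterionBoundGateBudget`; restricted-model proof complexity — nothing here bears on `P` versus `NP`).

`PstarCycleCoreKillsShared` (g28 §78) instantiates the shared-literal kill on an even circuit core for a member `e = (σ, p)` with ONE sibling.  This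
file is the same instantiation for the multi-sibling setting `PstarMultiSiblingSquare.Setup I K w₁ w₂ e σ p S q` (every output of `K ∪ G₁` through
`σ` is `e` or a sibling `o ∈ S`, `o = (σ, q o)`, `q o` private — e.g. `σ` a label carried by `e`, its `N`-sibling AND a clean chord or fold of the
certificate): even circuit core `K` (only `∅` and `K` even), arc `P ∋ e` (a join with the reader), reader linear part of XOR-type variables, typed
pure instance, privacy on `K ∪ G₁`, simple overlaps among the monomials of `Γ₂`.

* **`false_of_multi_sibling_cycle`** — CHECK-LIST: (idle) each of `K`, `P ∪ G₁`, `(K ∖ P) ∪ G₁` has a member off `σ` or value `0`; (partners)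
  every `Γ₂`-gate partner `u` off the block (`u ≠ σ, p, q o`) of a block variable is EITHER pinned on the other arc (`K ∖ P` and all folds through
  `u`, `v(K ∖ P, 1) = 1`) OR has a thaw pattern `Z ∋ σ` of AND-type variables containing its `K ∪ G₁`-partners with each of `K`, `P ∪ G₁`,
  `(K ∖ P) ∪ G₁` live or of value `0`.  Then (T3) with (M0) at `e` is contradictory; **`not_terminal_of_multi_sibling_cycle`**,
  **`not_terminalNC_of_multi_sibling_cycle`**;
* **`exists_gate_of_multi_sibling_cycle`** — the positive shape: a certificate needs a `Γ₂`-gate from the block to a variable `u` not pinned on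
  the other arc whose every admissible thaw pattern swallows, with value `1`, the core or an arc-with-folds;
* **`no_reader_of_multi_sibling_cycle`** — the `Γ₂`-free form: if every `u` off the block is pinned on the other arc or leaves `K`, `P ∪ G₁`,
  `(K ∖ P) ∪ G₁` each with a LIVE member (off `σ`, no AND variable a partner of `u`) or of value `0`, no second reader certifies through `e`;
* **`false_of_multi_sibling_evens`** (+ `not_terminal(NC)_of_multi_sibling_evens`) — the same on a GENERAL core from a census-supplied list
  `L ⊇ {even subfamilies of K}` (theta cores `K₄ − e`: `∅` and the three cycles), as in `PstarCoreKillsEvens` (g28 §78b): idle clause in raw join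
  form, thaw clauses per `E ∈ L`: `E` dead ⇒ `v(E,0) ≠ 1`, `(P ∆ E) ∪ G₁` dead ⇒ `v(P ∆ E,1) ≠ 1`.
-/

set_option linter.dupNamespace false -- `Summit.PneNP.PneNP.…`: summit = sub-problem name (D-0017 single-conjunct layout)

open Finset Literature.Computability.Complexity
open Summit.PneNP.PneNP.Theorems.PstarTyped (Typed)
open Summit.PneNP.PneNP.Theorems.PstarCoreBoundTargets (Terminal)
open Summit.PneNP.PneNP.Theorems.PstarUnion (SatPair)
open Summit.PneNP.PneNP.Theorems.PstarUnionCovers (TerminalNC)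
open Summit.PneNP.PneNP.Theorems.PstarChordBridgeTools (xpdeg)
open Summit.PneNP.PneNP.Theorems.PstarLiteralPinning (Through InSlice IsJoin joinValue)
open Summit.PneNP.PneNP.Theorems.PstarDeadPatterns (Dead)
open Summit.PneNP.PneNP.Theorems.PstarMultiSiblingSquare (Setup)
open Summit.PneNP.PneNP.Theorems.PstarCircuitJoins (isJoin_sdiff forall_join_of_four forall_join_of_evens joinValue_empty)
open Summit.PneNP.PneNP.Theorems.PstarMultiSiblingJoins (false_of_multi_sibling_joins)
open Summit.PneNP.PneNP.Theorems.PstarCycleCoreKills (through_ne_xor through_not_mem)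

namespace Summit.PneNP.PneNP.Theorems.PstarMultiSiblingCycle

variable {n m : ℕ} {I : LocalMap 4 n m} {y : Fin m → Bool} {K : Finset (Fin m)} {w₁ w₂ : Finset (Fin n) × Finset (Fin m) × Bool}
  {P : Finset (Fin m)} {e : Fin m} {σ p : Fin n} {S : Finset (Fin m)} {q : Fin m → Fin n}

/-! ## The multi-sibling member on a cycle core -/

section Multi

/-- **THE MULTI-SIBLING CHECK-LIST ON A CYCLE CORE.**  See the module docstring; conclusion: (T3) together with (M0) at `e` is contradictory. -/
theorem false_of_multi_sibling_cycle (H : Setup I K w₁ w₂ e σ p S q) (hT : Typed I)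
    (hKev : ∀ w, Even (xpdeg I K w)) (hmin : ∀ D ⊆ K, (∀ w, Even (xpdeg I D w)) → D = ∅ ∨ D = K)
    (hP : P ⊆ K) (hPJ : IsJoin I w₁.1 P true) (heP : e ∈ P)
    (hSG : ∀ g ∈ w₂.2.1, ∀ g' ∈ w₂.2.1, g' ≠ g → ¬ ((I.vars g' 2 = I.vars g 2 ∧ I.vars g' 3 = I.vars g 3) ∨
      (I.vars g' 2 = I.vars g 3 ∧ I.vars g' 3 = I.vars g 2)))
    (hC₁X : ∀ v ∈ w₁.1, ∃ j : Fin m, ∃ s : Fin 4, s.val < 2 ∧ I.vars j s = v)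
    (hpriv : ∀ j ∈ K ∪ w₁.2.1, ∃ a, Through I a j ∧ ∀ j' ∈ K ∪ w₁.2.1, Through I a j' → j' = j)
    (hidleK : (∀ j ∈ K, Through I σ j) → joinValue y w₁.2.2 K false ≠ 1)
    (hidleP : (∀ j ∈ P, Through I σ j) → (∀ g ∈ w₁.2.1, Through I σ g) → joinValue y w₁.2.2 P true ≠ 1)
    (hidleP' : (∀ j ∈ K \ P, Through I σ j) → (∀ g ∈ w₁.2.1, Through I σ g) → joinValue y w₁.2.2 (K \ P) true ≠ 1)
    (hpart : ∀ g ∈ w₂.2.1, ∀ u v : Fin n, (v = p ∨ v = σ ∨ ∃ o ∈ S, v = q o) → ((I.vars g 2 = v ∧ I.vars g 3 = u) ∨ (I.vars g 2 = u ∧ I.vars g 3 = v)) →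
      u ≠ p → u ≠ σ → (∀ o ∈ S, u ≠ q o) →
      ((∀ j ∈ K \ P, Through I u j) ∧ (∀ g' ∈ w₁.2.1, Through I u g') ∧ joinValue y w₁.2.2 (K \ P) true = 1) ∨
      ∃ Z : Finset (Fin n), σ ∈ Z ∧ (∀ w ∈ Z, ∃ j : Fin m, Through I w j) ∧
        (∀ j ∈ K ∪ w₁.2.1, (I.vars j 2 = u → I.vars j 3 ∈ Z) ∧ (I.vars j 3 = u → I.vars j 2 ∈ Z)) ∧
        ((∀ j ∈ K, Dead I Z j) → joinValue y w₁.2.2 K false ≠ 1) ∧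
        ((∀ j ∈ P, Dead I Z j) → (∀ g' ∈ w₁.2.1, Dead I Z g') → joinValue y w₁.2.2 P true ≠ 1) ∧
        ((∀ j ∈ K \ P, Dead I Z j) → (∀ g' ∈ w₁.2.1, Dead I Z g') → joinValue y w₁.2.2 (K \ P) true ≠ 1))
    (hT3 : ¬ SatPair I y K w₁ w₂) (hM0 : SatPair I y (K.erase e) w₁ w₂) : False := by
  have hC₁ : ∀ v ∈ w₁.1, ∀ j ∈ K ∪ w₁.2.1, ¬ Through I v j := fun v hv j _ hth => through_not_mem hT hC₁X hth hv
  -- the idle pattern `{σ}`: the four candidates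
  have hidle' : ∀ D ⊆ K, ∀ t : Bool, IsJoin I w₁.1 D t → (∀ j ∈ D, Through I σ j) → (t = true → ∀ g ∈ w₁.2.1, Through I σ g) →
      joinValue y w₁.2.2 D t ≠ 1 := by
    refine forall_join_of_four I hmin hP hPJ
      (fun D t => (∀ j ∈ D, Through I σ j) → (t = true → ∀ g ∈ w₁.2.1, Through I σ g) → joinValue y w₁.2.2 D t ≠ 1) ?_ ?_ ?_ ?_
    · intro _ _; rw [joinValue_empty]; exact zero_ne_one
    · exact fun hall _ => hidleK hall
    · exact fun hall hfolds => hidleP hall (hfolds rfl)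
    · exact fun hall hfolds => hidleP' hall (hfolds rfl)
  -- the partners
  have hpart' : ∀ g ∈ w₂.2.1, ∀ u v : Fin n, (v = p ∨ v = σ ∨ ∃ o ∈ S, v = q o) →
      ((I.vars g 2 = v ∧ I.vars g 3 = u) ∨ (I.vars g 2 = u ∧ I.vars g 3 = v)) → u ≠ p → u ≠ σ → (∀ o ∈ S, u ≠ q o) →
      (∃ D ⊆ K.erase e, ∃ t : Bool, IsJoin I w₁.1 D t ∧ (∀ j ∈ D, Through I u j) ∧ (t = true → ∀ g' ∈ w₁.2.1, Through I u g') ∧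
          joinValue y w₁.2.2 D t = 1) ∨
      (u ∉ w₁.1 ∧ (∀ j ∈ K, I.vars j 0 ≠ u ∧ I.vars j 1 ≠ u) ∧
        ∃ Z : Finset (Fin n), σ ∈ Z ∧ (∀ j ∈ K ∪ w₁.2.1, (I.vars j 2 = u → I.vars j 3 ∈ Z) ∧ (I.vars j 3 = u → I.vars j 2 ∈ Z)) ∧
          (∀ w ∈ Z, ∀ j ∈ K, I.vars j 0 ≠ w ∧ I.vars j 1 ≠ w) ∧ (∀ w ∈ Z, w ∉ w₁.1) ∧
          ∀ D ⊆ K, ∀ t : Bool, IsJoin I w₁.1 D t → (∀ j ∈ D, Dead I Z j) → (t = true → ∀ g' ∈ w₁.2.1, Dead I Z g') →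
            joinValue y w₁.2.2 D t ≠ 1) := by
    intro g hg u v hv hgs hup huσ huq
    have hug : Through I u g := by
      rcases hgs with ⟨_, h3⟩ | ⟨h2, _⟩
      · exact Or.inr h3
      · exact Or.inl h2
    rcases hpart g hg u v hv hgs hup huσ huq with ⟨hth, hfolds, hval⟩ | ⟨Z, hσZ, hZand, huZ, ha, hb, hc⟩
    · refine Or.inl ⟨K \ P, fun j hj => mem_erase.2 ⟨fun hje => (mem_sdiff.1 hj).2 (hje ▸ heP), (mem_sdiff.1 hj).1⟩, true,
        isJoin_sdiff I hKev hP hPJ, hth, fun _ => hfolds, hval⟩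
    · refine Or.inr ⟨through_not_mem hT hC₁X hug, fun j _ => through_ne_xor hT hug j, Z, hσZ, huZ,
        fun w hw j _ => ?_, fun w hw => ?_, ?_⟩
      · obtain ⟨j', hj'⟩ := hZand w hw; exact through_ne_xor hT hj' j
      · obtain ⟨j', hj'⟩ := hZand w hw; exact through_not_mem hT hC₁X hj'
      · refine forall_join_of_four I hmin hP hPJ
          (fun D t => (∀ j ∈ D, Dead I Z j) → (t = true → ∀ g' ∈ w₁.2.1, Dead I Z g') → joinValue y w₁.2.2 D t ≠ 1) ?_ ?_ ?_ ?_
        · intro _ _; rw [joinValue_empty]; exact zero_ne_one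
        · exact fun hall _ => ha hall
        · exact fun hall hfolds => hb hall (hfolds rfl)
        · exact fun hall hfolds => hc hall (hfolds rfl)
  exact false_of_multi_sibling_joins H hT hSG hC₁ hpriv hidle' hpart' hT3 hM0

/-- **The multi-sibling check-list kills a terminal core.** -/
theorem not_terminal_of_multi_sibling_cycle {r : ℕ} (H : Setup I K w₁ w₂ e σ p S q) (hT : Typed I)
    (hKev : ∀ w, Even (xpdeg I K w)) (hmin : ∀ D ⊆ K, (∀ w, Even (xpdeg I D w)) → D = ∅ ∨ D = K)
    (hP : P ⊆ K) (hPJ : IsJoin I w₁.1 P true) (heP : e ∈ P)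
    (hSG : ∀ g ∈ w₂.2.1, ∀ g' ∈ w₂.2.1, g' ≠ g → ¬ ((I.vars g' 2 = I.vars g 2 ∧ I.vars g' 3 = I.vars g 3) ∨
      (I.vars g' 2 = I.vars g 3 ∧ I.vars g' 3 = I.vars g 2)))
    (hC₁X : ∀ v ∈ w₁.1, ∃ j : Fin m, ∃ s : Fin 4, s.val < 2 ∧ I.vars j s = v)
    (hpriv : ∀ j ∈ K ∪ w₁.2.1, ∃ a, Through I a j ∧ ∀ j' ∈ K ∪ w₁.2.1, Through I a j' → j' = j)
    (hidleK : (∀ j ∈ K, Through I σ j) → joinValue y w₁.2.2 K false ≠ 1)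
    (hidleP : (∀ j ∈ P, Through I σ j) → (∀ g ∈ w₁.2.1, Through I σ g) → joinValue y w₁.2.2 P true ≠ 1)
    (hidleP' : (∀ j ∈ K \ P, Through I σ j) → (∀ g ∈ w₁.2.1, Through I σ g) → joinValue y w₁.2.2 (K \ P) true ≠ 1)
    (hpart : ∀ g ∈ w₂.2.1, ∀ u v : Fin n, (v = p ∨ v = σ ∨ ∃ o ∈ S, v = q o) → ((I.vars g 2 = v ∧ I.vars g 3 = u) ∨ (I.vars g 2 = u ∧ I.vars g 3 = v)) →
      u ≠ p → u ≠ σ → (∀ o ∈ S, u ≠ q o) →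
      ((∀ j ∈ K \ P, Through I u j) ∧ (∀ g' ∈ w₁.2.1, Through I u g') ∧ joinValue y w₁.2.2 (K \ P) true = 1) ∨
      ∃ Z : Finset (Fin n), σ ∈ Z ∧ (∀ w ∈ Z, ∃ j : Fin m, Through I w j) ∧
        (∀ j ∈ K ∪ w₁.2.1, (I.vars j 2 = u → I.vars j 3 ∈ Z) ∧ (I.vars j 3 = u → I.vars j 2 ∈ Z)) ∧
        ((∀ j ∈ K, Dead I Z j) → joinValue y w₁.2.2 K false ≠ 1) ∧
        ((∀ j ∈ P, Dead I Z j) → (∀ g' ∈ w₁.2.1, Dead I Z g') → joinValue y w₁.2.2 P true ≠ 1) ∧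
        ((∀ j ∈ K \ P, Dead I Z j) → (∀ g' ∈ w₁.2.1, Dead I Z g') → joinValue y w₁.2.2 (K \ P) true ≠ 1)) :
    ¬ Terminal I r y K w₁ w₂ := fun ht =>
  false_of_multi_sibling_cycle H hT hKev hmin hP hPJ heP hSG hC₁X hpriv hidleK hidleP hidleP' hpart ht.2.2.2.2.2.2.1
    (ht.2.2.2.2.2.2.2 e H.he)

/-- **The multi-sibling check-list kills a minimal core (`TerminalNC`).** -/
theorem not_terminalNC_of_multi_sibling_cycle {r : ℕ} (H : Setup I K w₁ w₂ e σ p S q) (hT : Typed I)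
    (hKev : ∀ w, Even (xpdeg I K w)) (hmin : ∀ D ⊆ K, (∀ w, Even (xpdeg I D w)) → D = ∅ ∨ D = K)
    (hP : P ⊆ K) (hPJ : IsJoin I w₁.1 P true) (heP : e ∈ P)
    (hSG : ∀ g ∈ w₂.2.1, ∀ g' ∈ w₂.2.1, g' ≠ g → ¬ ((I.vars g' 2 = I.vars g 2 ∧ I.vars g' 3 = I.vars g 3) ∨
      (I.vars g' 2 = I.vars g 3 ∧ I.vars g' 3 = I.vars g 2)))
    (hC₁X : ∀ v ∈ w₁.1, ∃ j : Fin m, ∃ s : Fin 4, s.val < 2 ∧ I.vars j s = v)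
    (hpriv : ∀ j ∈ K ∪ w₁.2.1, ∃ a, Through I a j ∧ ∀ j' ∈ K ∪ w₁.2.1, Through I a j' → j' = j)
    (hidleK : (∀ j ∈ K, Through I σ j) → joinValue y w₁.2.2 K false ≠ 1)
    (hidleP : (∀ j ∈ P, Through I σ j) → (∀ g ∈ w₁.2.1, Through I σ g) → joinValue y w₁.2.2 P true ≠ 1)
    (hidleP' : (∀ j ∈ K \ P, Through I σ j) → (∀ g ∈ w₁.2.1, Through I σ g) → joinValue y w₁.2.2 (K \ P) true ≠ 1)
    (hpart : ∀ g ∈ w₂.2.1, ∀ u v : Fin n, (v = p ∨ v = σ ∨ ∃ o ∈ S, v = q o) → ((I.vars g 2 = v ∧ I.vars g 3 = u) ∨ (I.vars g 2 = u ∧ I.vars g 3 = v)) →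
      u ≠ p → u ≠ σ → (∀ o ∈ S, u ≠ q o) →
      ((∀ j ∈ K \ P, Through I u j) ∧ (∀ g' ∈ w₁.2.1, Through I u g') ∧ joinValue y w₁.2.2 (K \ P) true = 1) ∨
      ∃ Z : Finset (Fin n), σ ∈ Z ∧ (∀ w ∈ Z, ∃ j : Fin m, Through I w j) ∧
        (∀ j ∈ K ∪ w₁.2.1, (I.vars j 2 = u → I.vars j 3 ∈ Z) ∧ (I.vars j 3 = u → I.vars j 2 ∈ Z)) ∧
        ((∀ j ∈ K, Dead I Z j) → joinValue y w₁.2.2 K false ≠ 1) ∧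
        ((∀ j ∈ P, Dead I Z j) → (∀ g' ∈ w₁.2.1, Dead I Z g') → joinValue y w₁.2.2 P true ≠ 1) ∧
        ((∀ j ∈ K \ P, Dead I Z j) → (∀ g' ∈ w₁.2.1, Dead I Z g') → joinValue y w₁.2.2 (K \ P) true ≠ 1)) :
    ¬ TerminalNC I r y K w₁ w₂ := fun ht =>
  false_of_multi_sibling_cycle H hT hKev hmin hP hPJ heP hSG hC₁X hpriv hidleK hidleP hidleP' hpart ht.2.2.2.2.2.1
    (ht.2.2.2.2.2.2 e H.he)

/-- **THE POSITIVE SHAPE AT A MULTI-SIBLING MEMBER** (contrapositive of `false_of_multi_sibling_cycle`): a certificate needs a `Γ₂`-gate linking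
`σ`, `p` or a `q o` to a variable `u` off the block not pinned on the other arc, all of whose admissible thaw patterns swallow, with value `1`,
the core or an arc-with-folds. -/
theorem exists_gate_of_multi_sibling_cycle (H : Setup I K w₁ w₂ e σ p S q) (hT : Typed I)
    (hKev : ∀ w, Even (xpdeg I K w)) (hmin : ∀ D ⊆ K, (∀ w, Even (xpdeg I D w)) → D = ∅ ∨ D = K)
    (hP : P ⊆ K) (hPJ : IsJoin I w₁.1 P true) (heP : e ∈ P)
    (hSG : ∀ g ∈ w₂.2.1, ∀ g' ∈ w₂.2.1, g' ≠ g → ¬ ((I.vars g' 2 = I.vars g 2 ∧ I.vars g' 3 = I.vars g 3) ∨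
      (I.vars g' 2 = I.vars g 3 ∧ I.vars g' 3 = I.vars g 2)))
    (hC₁X : ∀ v ∈ w₁.1, ∃ j : Fin m, ∃ s : Fin 4, s.val < 2 ∧ I.vars j s = v)
    (hpriv : ∀ j ∈ K ∪ w₁.2.1, ∃ a, Through I a j ∧ ∀ j' ∈ K ∪ w₁.2.1, Through I a j' → j' = j)
    (hidleK : (∀ j ∈ K, Through I σ j) → joinValue y w₁.2.2 K false ≠ 1)
    (hidleP : (∀ j ∈ P, Through I σ j) → (∀ g ∈ w₁.2.1, Through I σ g) → joinValue y w₁.2.2 P true ≠ 1)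
    (hidleP' : (∀ j ∈ K \ P, Through I σ j) → (∀ g ∈ w₁.2.1, Through I σ g) → joinValue y w₁.2.2 (K \ P) true ≠ 1)
    (hT3 : ¬ SatPair I y K w₁ w₂) (hM0 : SatPair I y (K.erase e) w₁ w₂) :
    ∃ g ∈ w₂.2.1, ∃ u v : Fin n, (v = p ∨ v = σ ∨ ∃ o ∈ S, v = q o) ∧ ((I.vars g 2 = v ∧ I.vars g 3 = u) ∨ (I.vars g 2 = u ∧ I.vars g 3 = v)) ∧
      u ≠ p ∧ u ≠ σ ∧ (∀ o ∈ S, u ≠ q o) ∧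
      ¬ ((∀ j ∈ K \ P, Through I u j) ∧ (∀ g' ∈ w₁.2.1, Through I u g') ∧ joinValue y w₁.2.2 (K \ P) true = 1) ∧
      ∀ Z : Finset (Fin n), σ ∈ Z → (∀ w ∈ Z, ∃ j : Fin m, Through I w j) →
        (∀ j ∈ K ∪ w₁.2.1, (I.vars j 2 = u → I.vars j 3 ∈ Z) ∧ (I.vars j 3 = u → I.vars j 2 ∈ Z)) →
        ((∀ j ∈ K, Dead I Z j) ∧ joinValue y w₁.2.2 K false = 1) ∨
        ((∀ j ∈ P, Dead I Z j) ∧ (∀ g' ∈ w₁.2.1, Dead I Z g') ∧ joinValue y w₁.2.2 P true = 1) ∨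
        ((∀ j ∈ K \ P, Dead I Z j) ∧ (∀ g' ∈ w₁.2.1, Dead I Z g') ∧ joinValue y w₁.2.2 (K \ P) true = 1) := by
  by_contra h
  refine false_of_multi_sibling_cycle H hT hKev hmin hP hPJ heP hSG hC₁X hpriv hidleK hidleP hidleP'
    (fun g hg u v hv hgs hup huσ huq => ?_) hT3 hM0
  by_contra h'
  rw [not_or] at h'
  refine h ⟨g, hg, u, v, hv, hgs, hup, huσ, huq, h'.1, fun Z hσZ hZand huZ => ?_⟩
  by_contra h''
  exact h'.2 ⟨Z, hσZ, hZand, huZ, fun hall hval => h'' (Or.inl ⟨hall, hval⟩),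
    fun hall hfolds hval => h'' (Or.inr (Or.inl ⟨hall, hfolds, hval⟩)),
    fun hall hfolds hval => h'' (Or.inr (Or.inr ⟨hall, hfolds, hval⟩))⟩

/-- **THE ARC OF A MULTI-SIBLING MEMBER ADMITS NO SECOND READER** (the `Γ₂`-free form of `false_of_multi_sibling_cycle`): call `j` LIVE for `u` if
`j` does not pass through `σ` and no AND variable of `j` is a `K ∪ G₁`-partner of `u`.  If every variable `u` off the block is pinned on the other arc
or leaves `K`, `P ∪ G₁`, `(K ∖ P) ∪ G₁` each with a live member or value `0`, then no second reader (simple overlaps, no gate `{σ,p}`, `{σ,q o}`) makes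
(T3) + (M0)-at-`e` hold. -/
theorem no_reader_of_multi_sibling_cycle (H : Setup I K w₁ w₂ e σ p S q) (hT : Typed I)
    (hKev : ∀ w, Even (xpdeg I K w)) (hmin : ∀ D ⊆ K, (∀ w, Even (xpdeg I D w)) → D = ∅ ∨ D = K)
    (hP : P ⊆ K) (hPJ : IsJoin I w₁.1 P true) (heP : e ∈ P)
    (hSG : ∀ g ∈ w₂.2.1, ∀ g' ∈ w₂.2.1, g' ≠ g → ¬ ((I.vars g' 2 = I.vars g 2 ∧ I.vars g' 3 = I.vars g 3) ∨
      (I.vars g' 2 = I.vars g 3 ∧ I.vars g' 3 = I.vars g 2)))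
    (hC₁X : ∀ v ∈ w₁.1, ∃ j : Fin m, ∃ s : Fin 4, s.val < 2 ∧ I.vars j s = v)
    (hpriv : ∀ j ∈ K ∪ w₁.2.1, ∃ a, Through I a j ∧ ∀ j' ∈ K ∪ w₁.2.1, Through I a j' → j' = j)
    (hidleK : (∀ j ∈ K, Through I σ j) → joinValue y w₁.2.2 K false ≠ 1)
    (hidleP : (∀ j ∈ P, Through I σ j) → (∀ g ∈ w₁.2.1, Through I σ g) → joinValue y w₁.2.2 P true ≠ 1)
    (hidleP' : (∀ j ∈ K \ P, Through I σ j) → (∀ g ∈ w₁.2.1, Through I σ g) → joinValue y w₁.2.2 (K \ P) true ≠ 1)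
    (hall : ∀ u : Fin n, u ≠ p → u ≠ σ → (∀ o ∈ S, u ≠ q o) →
      ((∀ j ∈ K \ P, Through I u j) ∧ (∀ g' ∈ w₁.2.1, Through I u g') ∧ joinValue y w₁.2.2 (K \ P) true = 1) ∨
      (((∀ j ∈ K, ¬ (¬ Through I σ j ∧ ∀ w, Through I w j → ∀ j' ∈ K ∪ w₁.2.1,
            ¬ ((I.vars j' 2 = u ∧ I.vars j' 3 = w) ∨ (I.vars j' 2 = w ∧ I.vars j' 3 = u)))) → joinValue y w₁.2.2 K false ≠ 1) ∧
        ((∀ j ∈ P ∪ w₁.2.1, ¬ (¬ Through I σ j ∧ ∀ w, Through I w j → ∀ j' ∈ K ∪ w₁.2.1,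
            ¬ ((I.vars j' 2 = u ∧ I.vars j' 3 = w) ∨ (I.vars j' 2 = w ∧ I.vars j' 3 = u)))) → joinValue y w₁.2.2 P true ≠ 1) ∧
        ((∀ j ∈ (K \ P) ∪ w₁.2.1, ¬ (¬ Through I σ j ∧ ∀ w, Through I w j → ∀ j' ∈ K ∪ w₁.2.1,
            ¬ ((I.vars j' 2 = u ∧ I.vars j' 3 = w) ∨ (I.vars j' 2 = w ∧ I.vars j' 3 = u)))) → joinValue y w₁.2.2 (K \ P) true ≠ 1)))
    (hT3 : ¬ SatPair I y K w₁ w₂) (hM0 : SatPair I y (K.erase e) w₁ w₂) : False := by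
  classical
  refine false_of_multi_sibling_cycle H hT hKev hmin hP hPJ heP hSG hC₁X hpriv hidleK hidleP hidleP'
    (fun g hg u v hv hgs hup huσ huq => ?_) hT3 hM0
  rcases hall u hup huσ huq with hpin | ⟨ha, hb, hc⟩
  · exact Or.inl hpin
  right
  set N : Finset (Fin n) := ((K ∪ w₁.2.1).filter (fun j => I.vars j 2 = u)).image (fun j => I.vars j 3) ∪
    ((K ∪ w₁.2.1).filter (fun j => I.vars j 3 = u)).image (fun j => I.vars j 2) with hNdef
  have hN : ∀ w, w ∈ N ↔ ∃ j' ∈ K ∪ w₁.2.1, (I.vars j' 2 = u ∧ I.vars j' 3 = w) ∨ (I.vars j' 2 = w ∧ I.vars j' 3 = u) := by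
    intro w
    simp only [hNdef, mem_union, mem_image, mem_filter]
    constructor
    · rintro (⟨j', ⟨hj', h2⟩, h3⟩ | ⟨j', ⟨hj', h3⟩, h2⟩)
      exacts [⟨j', hj', Or.inl ⟨h2, h3⟩⟩, ⟨j', hj', Or.inr ⟨h2, h3⟩⟩]
    · rintro ⟨j', hj', ⟨h2, h3⟩ | ⟨h2, h3⟩⟩
      exacts [Or.inl ⟨j', ⟨hj', h2⟩, h3⟩, Or.inr ⟨j', ⟨hj', h3⟩, h2⟩]
  have hσe : Through I σ e := by
    rcases H.hse with ⟨h2, _⟩ | ⟨_, h3⟩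
    exacts [Or.inl h2, Or.inr h3]
  have hdead : ∀ j, Dead I (insert σ N) j → ¬ (¬ Through I σ j ∧ ∀ w, Through I w j → ∀ j' ∈ K ∪ w₁.2.1,
      ¬ ((I.vars j' 2 = u ∧ I.vars j' 3 = w) ∨ (I.vars j' 2 = w ∧ I.vars j' 3 = u))) := by
    rintro j ⟨w, hw, hwj⟩ ⟨hσj, hlive⟩
    rcases mem_insert.1 hw with rfl | hwN
    · exact hσj hwj
    · obtain ⟨j', hj', hpair⟩ := (hN w).1 hwN
      exact hlive w hwj j' hj' hpair
  refine ⟨insert σ N, mem_insert_self σ N, ?_, ?_, ?_, ?_, ?_⟩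
  · intro w hw
    rcases mem_insert.1 hw with rfl | hwN
    · exact ⟨e, hσe⟩
    · obtain ⟨j', -, hpair⟩ := (hN w).1 hwN
      rcases hpair with ⟨_, h3⟩ | ⟨h2, _⟩
      · exact ⟨j', Or.inr h3⟩
      · exact ⟨j', Or.inl h2⟩
  · intro j hj
    exact ⟨fun h2 => mem_insert_of_mem ((hN _).2 ⟨j, hj, Or.inl ⟨h2, rfl⟩⟩),
      fun h3 => mem_insert_of_mem ((hN _).2 ⟨j, hj, Or.inr ⟨rfl, h3⟩⟩)⟩
  · exact fun hK => ha fun j hj => hdead j (hK j hj)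
  · exact fun hPd hGd => hb fun j hj => by
      rcases mem_union.1 hj with hj | hj
      exacts [hdead j (hPd j hj), hdead j (hGd j hj)]
  · exact fun hPd hGd => hc fun j hj => by
      rcases mem_union.1 hj with hj | hj
      exacts [hdead j (hPd j hj), hdead j (hGd j hj)]

end Multi

/-! ## The multi-sibling member on a general core, from the even list -/

section Evens

variable {L : Finset (Finset (Fin m))}

/-- **THE MULTI-SIBLING CHECK-LIST ON A GENERAL CORE** (even list `L ⊇ {even subfamilies of K}`, e.g. a theta core `K₄ − e`): idle candidates in
raw join form (they lie inside the block `{e} ∪ S`), partners via the even list.  Conclusion: (T3) with (M0) at `e` is contradictory. -/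
theorem false_of_multi_sibling_evens (H : Setup I K w₁ w₂ e σ p S q) (hT : Typed I)
    (hL : ∀ E ⊆ K, (∀ w, Even (xpdeg I E w)) → E ∈ L) (hP : P ⊆ K) (hPJ : IsJoin I w₁.1 P true)
    (hSG : ∀ g ∈ w₂.2.1, ∀ g' ∈ w₂.2.1, g' ≠ g → ¬ ((I.vars g' 2 = I.vars g 2 ∧ I.vars g' 3 = I.vars g 3) ∨
      (I.vars g' 2 = I.vars g 3 ∧ I.vars g' 3 = I.vars g 2)))
    (hC₁X : ∀ v ∈ w₁.1, ∃ j : Fin m, ∃ s : Fin 4, s.val < 2 ∧ I.vars j s = v)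
    (hpriv : ∀ j ∈ K ∪ w₁.2.1, ∃ a, Through I a j ∧ ∀ j' ∈ K ∪ w₁.2.1, Through I a j' → j' = j)
    (hidle : ∀ D ⊆ K, ∀ t : Bool, IsJoin I w₁.1 D t → (∀ j ∈ D, Through I σ j) → (t = true → ∀ g ∈ w₁.2.1, Through I σ g) →
      joinValue y w₁.2.2 D t ≠ 1)
    (hpart : ∀ g ∈ w₂.2.1, ∀ u v : Fin n, (v = p ∨ v = σ ∨ ∃ o ∈ S, v = q o) → ((I.vars g 2 = v ∧ I.vars g 3 = u) ∨ (I.vars g 2 = u ∧ I.vars g 3 = v)) →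
      u ≠ p → u ≠ σ → (∀ o ∈ S, u ≠ q o) →
      (∃ D ⊆ K.erase e, ∃ t : Bool, IsJoin I w₁.1 D t ∧ (∀ j ∈ D, Through I u j) ∧ (t = true → ∀ g' ∈ w₁.2.1, Through I u g') ∧
          joinValue y w₁.2.2 D t = 1) ∨
      ∃ Z : Finset (Fin n), σ ∈ Z ∧ (∀ w ∈ Z, ∃ j : Fin m, Through I w j) ∧
        (∀ j ∈ K ∪ w₁.2.1, (I.vars j 2 = u → I.vars j 3 ∈ Z) ∧ (I.vars j 3 = u → I.vars j 2 ∈ Z)) ∧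
        (∀ E ∈ L, (∀ j ∈ E, Dead I Z j) → joinValue y w₁.2.2 E false ≠ 1) ∧
        (∀ E ∈ L, (∀ j ∈ (P \ E) ∪ (E \ P), Dead I Z j) → (∀ g' ∈ w₁.2.1, Dead I Z g') →
          joinValue y w₁.2.2 ((P \ E) ∪ (E \ P)) true ≠ 1))
    (hT3 : ¬ SatPair I y K w₁ w₂) (hM0 : SatPair I y (K.erase e) w₁ w₂) : False := by
  have hC₁ : ∀ v ∈ w₁.1, ∀ j ∈ K ∪ w₁.2.1, ¬ Through I v j := fun v hv j _ hth => through_not_mem hT hC₁X hth hv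
  have hpart' : ∀ g ∈ w₂.2.1, ∀ u v : Fin n, (v = p ∨ v = σ ∨ ∃ o ∈ S, v = q o) →
      ((I.vars g 2 = v ∧ I.vars g 3 = u) ∨ (I.vars g 2 = u ∧ I.vars g 3 = v)) → u ≠ p → u ≠ σ → (∀ o ∈ S, u ≠ q o) →
      (∃ D ⊆ K.erase e, ∃ t : Bool, IsJoin I w₁.1 D t ∧ (∀ j ∈ D, Through I u j) ∧ (t = true → ∀ g' ∈ w₁.2.1, Through I u g') ∧
          joinValue y w₁.2.2 D t = 1) ∨
      (u ∉ w₁.1 ∧ (∀ j ∈ K, I.vars j 0 ≠ u ∧ I.vars j 1 ≠ u) ∧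
        ∃ Z : Finset (Fin n), σ ∈ Z ∧ (∀ j ∈ K ∪ w₁.2.1, (I.vars j 2 = u → I.vars j 3 ∈ Z) ∧ (I.vars j 3 = u → I.vars j 2 ∈ Z)) ∧
          (∀ w ∈ Z, ∀ j ∈ K, I.vars j 0 ≠ w ∧ I.vars j 1 ≠ w) ∧ (∀ w ∈ Z, w ∉ w₁.1) ∧
          ∀ D ⊆ K, ∀ t : Bool, IsJoin I w₁.1 D t → (∀ j ∈ D, Dead I Z j) → (t = true → ∀ g' ∈ w₁.2.1, Dead I Z g') →
            joinValue y w₁.2.2 D t ≠ 1) := by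
    intro g hg u v hv hgs hup huσ huq
    have hug : Through I u g := by
      rcases hgs with ⟨_, h3⟩ | ⟨h2, _⟩
      · exact Or.inr h3
      · exact Or.inl h2
    rcases hpart g hg u v hv hgs hup huσ huq with hpin | ⟨Z, hσZ, hZand, huZ, h0, h1⟩
    · exact Or.inl hpin
    · refine Or.inr ⟨through_not_mem hT hC₁X hug, fun j _ => through_ne_xor hT hug j, Z, hσZ, huZ,
        fun w hw j _ => ?_, fun w hw => ?_, ?_⟩
      · obtain ⟨j', hj'⟩ := hZand w hw; exact through_ne_xor hT hj' j
      · obtain ⟨j', hj'⟩ := hZand w hw; exact through_not_mem hT hC₁X hj'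
      · exact forall_join_of_evens I L hL hP hPJ
          (fun D t => (∀ j ∈ D, Dead I Z j) → (t = true → ∀ g' ∈ w₁.2.1, Dead I Z g') → joinValue y w₁.2.2 D t ≠ 1)
          (fun E hE hall _ => h0 E hE hall) (fun E hE hall hfolds => h1 E hE hall (hfolds rfl))
  exact false_of_multi_sibling_joins H hT hSG hC₁ hpriv hidle hpart' hT3 hM0

/-- **The multi-sibling check-list (even list) kills a terminal core.** -/
theorem not_terminal_of_multi_sibling_evens {r : ℕ} (H : Setup I K w₁ w₂ e σ p S q) (hT : Typed I)
    (hL : ∀ E ⊆ K, (∀ w, Even (xpdeg I E w)) → E ∈ L) (hP : P ⊆ K) (hPJ : IsJoin I w₁.1 P true)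
    (hSG : ∀ g ∈ w₂.2.1, ∀ g' ∈ w₂.2.1, g' ≠ g → ¬ ((I.vars g' 2 = I.vars g 2 ∧ I.vars g' 3 = I.vars g 3) ∨
      (I.vars g' 2 = I.vars g 3 ∧ I.vars g' 3 = I.vars g 2)))
    (hC₁X : ∀ v ∈ w₁.1, ∃ j : Fin m, ∃ s : Fin 4, s.val < 2 ∧ I.vars j s = v)
    (hpriv : ∀ j ∈ K ∪ w₁.2.1, ∃ a, Through I a j ∧ ∀ j' ∈ K ∪ w₁.2.1, Through I a j' → j' = j)
    (hidle : ∀ D ⊆ K, ∀ t : Bool, IsJoin I w₁.1 D t → (∀ j ∈ D, Through I σ j) → (t = true → ∀ g ∈ w₁.2.1, Through I σ g) →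
      joinValue y w₁.2.2 D t ≠ 1)
    (hpart : ∀ g ∈ w₂.2.1, ∀ u v : Fin n, (v = p ∨ v = σ ∨ ∃ o ∈ S, v = q o) → ((I.vars g 2 = v ∧ I.vars g 3 = u) ∨ (I.vars g 2 = u ∧ I.vars g 3 = v)) →
      u ≠ p → u ≠ σ → (∀ o ∈ S, u ≠ q o) →
      (∃ D ⊆ K.erase e, ∃ t : Bool, IsJoin I w₁.1 D t ∧ (∀ j ∈ D, Through I u j) ∧ (t = true → ∀ g' ∈ w₁.2.1, Through I u g') ∧
          joinValue y w₁.2.2 D t = 1) ∨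
      ∃ Z : Finset (Fin n), σ ∈ Z ∧ (∀ w ∈ Z, ∃ j : Fin m, Through I w j) ∧
        (∀ j ∈ K ∪ w₁.2.1, (I.vars j 2 = u → I.vars j 3 ∈ Z) ∧ (I.vars j 3 = u → I.vars j 2 ∈ Z)) ∧
        (∀ E ∈ L, (∀ j ∈ E, Dead I Z j) → joinValue y w₁.2.2 E false ≠ 1) ∧
        (∀ E ∈ L, (∀ j ∈ (P \ E) ∪ (E \ P), Dead I Z j) → (∀ g' ∈ w₁.2.1, Dead I Z g') →
          joinValue y w₁.2.2 ((P \ E) ∪ (E \ P)) true ≠ 1)) :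
    ¬ Terminal I r y K w₁ w₂ := fun ht =>
  false_of_multi_sibling_evens H hT hL hP hPJ hSG hC₁X hpriv hidle hpart ht.2.2.2.2.2.2.1 (ht.2.2.2.2.2.2.2 e H.he)

/-- **The multi-sibling check-list (even list) kills a minimal core (`TerminalNC`).** -/
theorem not_terminalNC_of_multi_sibling_evens {r : ℕ} (H : Setup I K w₁ w₂ e σ p S q) (hT : Typed I)
    (hL : ∀ E ⊆ K, (∀ w, Even (xpdeg I E w)) → E ∈ L) (hP : P ⊆ K) (hPJ : IsJoin I w₁.1 P true)
    (hSG : ∀ g ∈ w₂.2.1, ∀ g' ∈ w₂.2.1, g' ≠ g → ¬ ((I.vars g' 2 = I.vars g 2 ∧ I.vars g' 3 = I.vars g 3) ∨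
      (I.vars g' 2 = I.vars g 3 ∧ I.vars g' 3 = I.vars g 2)))
    (hC₁X : ∀ v ∈ w₁.1, ∃ j : Fin m, ∃ s : Fin 4, s.val < 2 ∧ I.vars j s = v)
    (hpriv : ∀ j ∈ K ∪ w₁.2.1, ∃ a, Through I a j ∧ ∀ j' ∈ K ∪ w₁.2.1, Through I a j' → j' = j)
    (hidle : ∀ D ⊆ K, ∀ t : Bool, IsJoin I w₁.1 D t → (∀ j ∈ D, Through I σ j) → (t = true → ∀ g ∈ w₁.2.1, Through I σ g) →
      joinValue y w₁.2.2 D t ≠ 1)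
    (hpart : ∀ g ∈ w₂.2.1, ∀ u v : Fin n, (v = p ∨ v = σ ∨ ∃ o ∈ S, v = q o) → ((I.vars g 2 = v ∧ I.vars g 3 = u) ∨ (I.vars g 2 = u ∧ I.vars g 3 = v)) →
      u ≠ p → u ≠ σ → (∀ o ∈ S, u ≠ q o) →
      (∃ D ⊆ K.erase e, ∃ t : Bool, IsJoin I w₁.1 D t ∧ (∀ j ∈ D, Through I u j) ∧ (t = true → ∀ g' ∈ w₁.2.1, Through I u g') ∧
          joinValue y w₁.2.2 D t = 1) ∨
      ∃ Z : Finset (Fin n), σ ∈ Z ∧ (∀ w ∈ Z, ∃ j : Fin m, Through I w j) ∧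
        (∀ j ∈ K ∪ w₁.2.1, (I.vars j 2 = u → I.vars j 3 ∈ Z) ∧ (I.vars j 3 = u → I.vars j 2 ∈ Z)) ∧
        (∀ E ∈ L, (∀ j ∈ E, Dead I Z j) → joinValue y w₁.2.2 E false ≠ 1) ∧
        (∀ E ∈ L, (∀ j ∈ (P \ E) ∪ (E \ P), Dead I Z j) → (∀ g' ∈ w₁.2.1, Dead I Z g') →
          joinValue y w₁.2.2 ((P \ E) ∪ (E \ P)) true ≠ 1)) :
    ¬ TerminalNC I r y K w₁ w₂ := fun ht =>
  false_of_multi_sibling_evens H hT hL hP hPJ hSG hC₁X hpriv hidle hpart ht.2.2.2.2.2.1 (ht.2.2.2.2.2.2 e H.he)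

end Evens

end Summit.PneNP.PneNP.Theorems.PstarMultiSiblingCycle
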